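import Summits.QuantumFields.YangMills.Theorems.FluctuationComparisonRegPrIntLOrganTangentJunctionDirectTransportCore
import HarnessLib

/-!
# THE `HClauseSq` ALGEBRA (1∕2) — def-free lemmas over the scaled one-bond-pair clause TEXT (tool brick «KIT» of LEAD-20520 w3 g25 №3)

Cell `ym3-torus` (YM ladder rung R3 = continuum `SU(2)` Yang–Mills on the three-torus — a RUNG: NOT d = 4, NOT infinite volume, NOT a mass
gap, NOT Clay).  Seat `ym-line-cst-p1` g41 (FREE hand; brick «KIT» named by LEAD w3 g25 №3, 2026-08-31); crux `stmt-QuantumFields-20520`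
(`…Theses.UnitScaleTilt.FluctuationComparisonRegPrIntL`), organ-tangent lane; `--kind proof --supports stmt-QuantumFields-20520 --as helper`:
count-neutral, DEFINITION-FREE (0 `def`, 0 `instance`, 0 `notation`, 0 `sorry`, default heartbeats), no registry ∕ binder ∕ `Lines/` byte.

WHAT.  The H-currency of the v18 texts is the SCALED ONE-BOND-PAIR CLAUSE (`Cruxes/…/V18DraftTexts.lean` v0.3 `HClauseSq θ r k R`; tree text =
✓p797413 `firstDiff_window_path`'s hypothesis `h`, byte-identical body):

  `∀ b b' v v' U V W Z, ‖v‖ ≤ r·θ → ‖v'‖ ≤ r·θ → PlaqSmall θ U,V,W,Z → (V = U·e^{v} at b) → (W = U·e^{v'} at b') → (Z = V·e^{v'} at b') →`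
  `|R Z − R V − R W + R U| ≤ k b b' · (‖v‖∕θ) · (‖v'‖∕θ)`,

together with the ROW-MASS text `∀ b, Σ_{b'} k b b'·e^{κ·tdist(b.src, b'.src)} ≤ w` and the bundled `∃ k`-BLOCK
`∃ k, (∀ b b', 0 ≤ k b b') ∧ ⟨row-mass ≤ w⟩ ∧ ⟨clause θ r k R⟩` (the inner block of O1ᵘ-H v2 ∕ LINᵘ-H ∕ JENᵘ-H's conclusions, BRICK 1
✓`OrganTangentTaylorCutH`).  Crux workfiles are not importable from `Theorems/`, so every lemma below carries the clause TEXT written out, for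
ABSTRACT `R R₁ R₂ : GaugeField P j SU(2) → ℝ`, letters `k k₁ k₂`, window ∕ cap `θ θ' r r'`; a consumer holding `h : HClauseSq θ r k R` applies them by
`exact` (δ-unfolding), exactly as BRICK 1 consumes px19's `hO`.

* §1 THE CLAUSE: (K0) `hClauseSq_congr` (pointwise-equal `R` on the window, larger letters); (K1) `hClauseSq_add`, `hClauseSq_sum` (finite sums);
  (K2) `hClauseSq_smul` (`|c|·k`), `hClauseSq_smul_of_nonneg`, `hClauseSq_neg`, `hClauseSq_sub`; (K3) `hClauseSq_cap_mono` (antitone in the cap `r`),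
  `hClauseSq_letter_mono`; (K4) `hClauseSq_window` (window∕scale change `θ' ≤ θ`, `r'θ' ≤ rθ`, letters `(θ'∕θ)²·k`); (K5) `hClauseSq_const`,
  `hClauseSq_add_const` (bond-independent addends); (K7) `hClauseSq_integral` (closure under `μ`-averages of clause-holders, letters `B·μ(T)·k`).
* §2 THE ROW MASS: `rowMass_add_le`, `rowMass_sum_le`, `rowMass_smul_le`, `rowMass_abs_smul_le`, `rowMass_zero_le`, `rowMass_le_of_letter_le`,
  `rowMass_window_le`; the rate-monotonicity `κ' ≤ κ` and `k b b' ≤ w` are ✓px19 Core `rowMass_mono` ∕ `letter_le_rowMass` (IMPORTED, not restated).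
* THE `∃ k`-BLOCK (`block_add`, `block_smul`, `block_neg`, `block_sub`, `block_cap_mono`, `block_window`, `block_rate_mono`, `block_weight_mono`,
  `block_const`) is the companion file (2∕2) `…OrganTangentHClauseBlock` (400-line rule).

WHY (LEAD w3 g25 №3).  BRICK 1 proved (K1)(K3) inline; px5 g19's JVARᵘ-H corollary, w4 g22's E-H road, px13's (MH) and BRICK 2a all move pieces
between presentations of the same clause — these are the by-name handles.  [folklore] throughout: real inequalities, `Finset` sums, one Bochner
`norm_integral_le_of_norm_le_const`.

HONEST.  Bookkeeping only; nothing of Bałaban's is asserted or proved; LINᵘ-H, JENᵘ-H, O1ᵘ-H v2 (XL), S1aᴴ, S2β's five registered stubs, crux 20520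
and the leaf `YM3TorusSU2` are NOT proved; rung R3 = SU(2) YM₃ on T³ at fixed lattice data — NOT d = 4, NOT infinite volume, NOT a mass gap, NOT Clay;
the Yang–Mills mass gap is NOT proved.  Sorry-free, axioms standard.
-/

set_option autoImplicit false

noncomputable section

open MeasureTheory
open Literature.MathematicalPhysics.QuantumFieldTheory.Balaban1983to89
open T4CubeChartExp (expPt)
open T3PrintedMinimiserExistence (plaqSmall_of_le)
open Summit.QuantumFields.YangMills.Theorems.OrganTangentJunctionDirectTransportCore (rowMass_mono)
open scoped BigOperators

namespace Summit.QuantumFields.YangMills.Theorems.OrganTangentHClauseAlgebra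

variable {P : Params} {j : ℕ}

/-! ## §1 The clause algebra -/

section Clause

variable {θ r : ℝ} {k k₁ k₂ k' : PBond P j → PBond P j → ℝ}
  {R R₁ R₂ R' : GaugeField P j (Matrix.specialUnitaryGroup (Fin 2) ℂ) → ℝ}

/-- (K0) **CONGRUENCE**: the clause passes to any `R'` agreeing with `R` on the `θ`-window and to any larger letters `k'`. [folklore] -/
theorem hClauseSq_congr
    (h : ∀ (b b' : PBond P j) (v v' : Fin 3 → ℝ) (U V W Z : GaugeField P j (Matrix.specialUnitaryGroup (Fin 2) ℂ)),
      ‖v‖ ≤ r * θ → ‖v'‖ ≤ r * θ → PlaqSmall θ U → PlaqSmall θ V → PlaqSmall θ W → PlaqSmall θ Z →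
      (∀ e, e ≠ b → V e = U e) → V b = U b * expPt v → (∀ e, e ≠ b' → W e = U e) → W b' = U b' * expPt v' →
      (∀ e, e ≠ b' → Z e = V e) → Z b' = V b' * expPt v' →
      |R Z - R V - R W + R U| ≤ k b b' * (‖v‖ / θ) * (‖v'‖ / θ))
    (hR : ∀ U, PlaqSmall θ U → R' U = R U) (hk : ∀ b b', k b b' ≤ k' b b') :
    ∀ (b b' : PBond P j) (v v' : Fin 3 → ℝ) (U V W Z : GaugeField P j (Matrix.specialUnitaryGroup (Fin 2) ℂ)),
      ‖v‖ ≤ r * θ → ‖v'‖ ≤ r * θ → PlaqSmall θ U → PlaqSmall θ V → PlaqSmall θ W → PlaqSmall θ Z →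
      (∀ e, e ≠ b → V e = U e) → V b = U b * expPt v → (∀ e, e ≠ b' → W e = U e) → W b' = U b' * expPt v' →
      (∀ e, e ≠ b' → Z e = V e) → Z b' = V b' * expPt v' →
      |R' Z - R' V - R' W + R' U| ≤ k' b b' * (‖v‖ / θ) * (‖v'‖ / θ) := by
  intro b b' v v' U V W Z hv hv' hU hV hW hZ e1 e2 e3 e4 e5 e6
  rw [hR U hU, hR V hV, hR W hW, hR Z hZ]
  have hx : 0 ≤ (‖v‖ / θ) * (‖v'‖ / θ) := by
    rw [div_mul_div_comm]; exact div_nonneg (mul_nonneg (norm_nonneg _) (norm_nonneg _)) (mul_self_nonneg θ)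
  calc |R Z - R V - R W + R U| ≤ k b b' * (‖v‖ / θ) * (‖v'‖ / θ) := h b b' v v' U V W Z hv hv' hU hV hW hZ e1 e2 e3 e4 e5 e6
    _ = k b b' * ((‖v‖ / θ) * (‖v'‖ / θ)) := mul_assoc _ _ _
    _ ≤ k' b b' * ((‖v‖ / θ) * (‖v'‖ / θ)) := mul_le_mul_of_nonneg_right (hk b b') hx
    _ = k' b b' * (‖v‖ / θ) * (‖v'‖ / θ) := (mul_assoc _ _ _).symm

/-- (K1) **ADDITIVITY**: clauses for `R₁` (letters `k₁`) and `R₂` (letters `k₂`) give the clause for `R₁ + R₂` with letters `k₁ + k₂`. [folklore] -/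
theorem hClauseSq_add
    (h₁ : ∀ (b b' : PBond P j) (v v' : Fin 3 → ℝ) (U V W Z : GaugeField P j (Matrix.specialUnitaryGroup (Fin 2) ℂ)),
      ‖v‖ ≤ r * θ → ‖v'‖ ≤ r * θ → PlaqSmall θ U → PlaqSmall θ V → PlaqSmall θ W → PlaqSmall θ Z →
      (∀ e, e ≠ b → V e = U e) → V b = U b * expPt v → (∀ e, e ≠ b' → W e = U e) → W b' = U b' * expPt v' →
      (∀ e, e ≠ b' → Z e = V e) → Z b' = V b' * expPt v' →
      |R₁ Z - R₁ V - R₁ W + R₁ U| ≤ k₁ b b' * (‖v‖ / θ) * (‖v'‖ / θ))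
    (h₂ : ∀ (b b' : PBond P j) (v v' : Fin 3 → ℝ) (U V W Z : GaugeField P j (Matrix.specialUnitaryGroup (Fin 2) ℂ)),
      ‖v‖ ≤ r * θ → ‖v'‖ ≤ r * θ → PlaqSmall θ U → PlaqSmall θ V → PlaqSmall θ W → PlaqSmall θ Z →
      (∀ e, e ≠ b → V e = U e) → V b = U b * expPt v → (∀ e, e ≠ b' → W e = U e) → W b' = U b' * expPt v' →
      (∀ e, e ≠ b' → Z e = V e) → Z b' = V b' * expPt v' →
      |R₂ Z - R₂ V - R₂ W + R₂ U| ≤ k₂ b b' * (‖v‖ / θ) * (‖v'‖ / θ)) :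
    ∀ (b b' : PBond P j) (v v' : Fin 3 → ℝ) (U V W Z : GaugeField P j (Matrix.specialUnitaryGroup (Fin 2) ℂ)),
      ‖v‖ ≤ r * θ → ‖v'‖ ≤ r * θ → PlaqSmall θ U → PlaqSmall θ V → PlaqSmall θ W → PlaqSmall θ Z →
      (∀ e, e ≠ b → V e = U e) → V b = U b * expPt v → (∀ e, e ≠ b' → W e = U e) → W b' = U b' * expPt v' →
      (∀ e, e ≠ b' → Z e = V e) → Z b' = V b' * expPt v' →
      |(R₁ Z + R₂ Z) - (R₁ V + R₂ V) - (R₁ W + R₂ W) + (R₁ U + R₂ U)| ≤ (k₁ b b' + k₂ b b') * (‖v‖ / θ) * (‖v'‖ / θ) := by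
  intro b b' v v' U V W Z hv hv' hU hV hW hZ e1 e2 e3 e4 e5 e6
  have A := h₁ b b' v v' U V W Z hv hv' hU hV hW hZ e1 e2 e3 e4 e5 e6
  have B := h₂ b b' v v' U V W Z hv hv' hU hV hW hZ e1 e2 e3 e4 e5 e6
  have e : (R₁ Z + R₂ Z) - (R₁ V + R₂ V) - (R₁ W + R₂ W) + (R₁ U + R₂ U) =
      (R₁ Z - R₁ V - R₁ W + R₁ U) + (R₂ Z - R₂ V - R₂ W + R₂ U) := by ring
  rw [e, add_mul, add_mul]
  exact (abs_add_le _ _).trans (add_le_add A B)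

/-- (K1, finite form) **FINITE SUMS**: if every `R i`, `i ∈ s`, satisfies the clause with letters `k i`, then `Σ_{i ∈ s} R i` satisfies it with
letters `Σ_{i ∈ s} k i`. [folklore] -/
theorem hClauseSq_sum {ι : Type*} (s : Finset ι) {Rf : ι → GaugeField P j (Matrix.specialUnitaryGroup (Fin 2) ℂ) → ℝ}
    {kf : ι → PBond P j → PBond P j → ℝ}
    (h : ∀ i ∈ s, ∀ (b b' : PBond P j) (v v' : Fin 3 → ℝ) (U V W Z : GaugeField P j (Matrix.specialUnitaryGroup (Fin 2) ℂ)),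
      ‖v‖ ≤ r * θ → ‖v'‖ ≤ r * θ → PlaqSmall θ U → PlaqSmall θ V → PlaqSmall θ W → PlaqSmall θ Z →
      (∀ e, e ≠ b → V e = U e) → V b = U b * expPt v → (∀ e, e ≠ b' → W e = U e) → W b' = U b' * expPt v' →
      (∀ e, e ≠ b' → Z e = V e) → Z b' = V b' * expPt v' →
      |Rf i Z - Rf i V - Rf i W + Rf i U| ≤ kf i b b' * (‖v‖ / θ) * (‖v'‖ / θ)) :
    ∀ (b b' : PBond P j) (v v' : Fin 3 → ℝ) (U V W Z : GaugeField P j (Matrix.specialUnitaryGroup (Fin 2) ℂ)),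
      ‖v‖ ≤ r * θ → ‖v'‖ ≤ r * θ → PlaqSmall θ U → PlaqSmall θ V → PlaqSmall θ W → PlaqSmall θ Z →
      (∀ e, e ≠ b → V e = U e) → V b = U b * expPt v → (∀ e, e ≠ b' → W e = U e) → W b' = U b' * expPt v' →
      (∀ e, e ≠ b' → Z e = V e) → Z b' = V b' * expPt v' →
      |(∑ i ∈ s, Rf i Z) - (∑ i ∈ s, Rf i V) - (∑ i ∈ s, Rf i W) + (∑ i ∈ s, Rf i U)| ≤
        (∑ i ∈ s, kf i b b') * (‖v‖ / θ) * (‖v'‖ / θ) := by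
  intro b b' v v' U V W Z hv hv' hU hV hW hZ e1 e2 e3 e4 e5 e6
  have e : (∑ i ∈ s, Rf i Z) - (∑ i ∈ s, Rf i V) - (∑ i ∈ s, Rf i W) + (∑ i ∈ s, Rf i U) =
      ∑ i ∈ s, (Rf i Z - Rf i V - Rf i W + Rf i U) := by
    simp only [Finset.sum_add_distrib, Finset.sum_sub_distrib]
  rw [e, Finset.sum_mul, Finset.sum_mul]
  exact (Finset.abs_sum_le_sum_abs _ _).trans (Finset.sum_le_sum fun i hi => h i hi b b' v v' U V W Z hv hv' hU hV hW hZ e1 e2 e3 e4 e5 e6)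

/-- (K2) **SCALARS**: the clause for `R` with letters `k` gives the clause for `c·R` with letters `|c|·k`. [folklore] -/
theorem hClauseSq_smul (c : ℝ)
    (h : ∀ (b b' : PBond P j) (v v' : Fin 3 → ℝ) (U V W Z : GaugeField P j (Matrix.specialUnitaryGroup (Fin 2) ℂ)),
      ‖v‖ ≤ r * θ → ‖v'‖ ≤ r * θ → PlaqSmall θ U → PlaqSmall θ V → PlaqSmall θ W → PlaqSmall θ Z →
      (∀ e, e ≠ b → V e = U e) → V b = U b * expPt v → (∀ e, e ≠ b' → W e = U e) → W b' = U b' * expPt v' →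
      (∀ e, e ≠ b' → Z e = V e) → Z b' = V b' * expPt v' →
      |R Z - R V - R W + R U| ≤ k b b' * (‖v‖ / θ) * (‖v'‖ / θ)) :
    ∀ (b b' : PBond P j) (v v' : Fin 3 → ℝ) (U V W Z : GaugeField P j (Matrix.specialUnitaryGroup (Fin 2) ℂ)),
      ‖v‖ ≤ r * θ → ‖v'‖ ≤ r * θ → PlaqSmall θ U → PlaqSmall θ V → PlaqSmall θ W → PlaqSmall θ Z →
      (∀ e, e ≠ b → V e = U e) → V b = U b * expPt v → (∀ e, e ≠ b' → W e = U e) → W b' = U b' * expPt v' →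
      (∀ e, e ≠ b' → Z e = V e) → Z b' = V b' * expPt v' →
      |c * R Z - c * R V - c * R W + c * R U| ≤ (|c| * k b b') * (‖v‖ / θ) * (‖v'‖ / θ) := by
  intro b b' v v' U V W Z hv hv' hU hV hW hZ e1 e2 e3 e4 e5 e6
  have A := h b b' v v' U V W Z hv hv' hU hV hW hZ e1 e2 e3 e4 e5 e6
  have e : c * R Z - c * R V - c * R W + c * R U = c * (R Z - R V - R W + R U) := by ring
  rw [e, abs_mul, mul_assoc |c|, mul_assoc |c|]
  exact mul_le_mul_of_nonneg_left (by simpa [mul_assoc] using A) (abs_nonneg c)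

/-- (K2) **NON-NEGATIVE SCALARS**: for `0 ≤ c` the letters are `c·k`. [folklore] -/
theorem hClauseSq_smul_of_nonneg {c : ℝ} (hc : 0 ≤ c)
    (h : ∀ (b b' : PBond P j) (v v' : Fin 3 → ℝ) (U V W Z : GaugeField P j (Matrix.specialUnitaryGroup (Fin 2) ℂ)),
      ‖v‖ ≤ r * θ → ‖v'‖ ≤ r * θ → PlaqSmall θ U → PlaqSmall θ V → PlaqSmall θ W → PlaqSmall θ Z →
      (∀ e, e ≠ b → V e = U e) → V b = U b * expPt v → (∀ e, e ≠ b' → W e = U e) → W b' = U b' * expPt v' →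
      (∀ e, e ≠ b' → Z e = V e) → Z b' = V b' * expPt v' →
      |R Z - R V - R W + R U| ≤ k b b' * (‖v‖ / θ) * (‖v'‖ / θ)) :
    ∀ (b b' : PBond P j) (v v' : Fin 3 → ℝ) (U V W Z : GaugeField P j (Matrix.specialUnitaryGroup (Fin 2) ℂ)),
      ‖v‖ ≤ r * θ → ‖v'‖ ≤ r * θ → PlaqSmall θ U → PlaqSmall θ V → PlaqSmall θ W → PlaqSmall θ Z →
      (∀ e, e ≠ b → V e = U e) → V b = U b * expPt v → (∀ e, e ≠ b' → W e = U e) → W b' = U b' * expPt v' →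
      (∀ e, e ≠ b' → Z e = V e) → Z b' = V b' * expPt v' →
      |c * R Z - c * R V - c * R W + c * R U| ≤ (c * k b b') * (‖v‖ / θ) * (‖v'‖ / θ) := by
  have H := hClauseSq_smul c h
  rw [abs_of_nonneg hc] at H
  exact H

/-- (K2) **NEGATION**: the clause for `R` gives the clause for `−R` with the same letters. [folklore] -/
theorem hClauseSq_neg
    (h : ∀ (b b' : PBond P j) (v v' : Fin 3 → ℝ) (U V W Z : GaugeField P j (Matrix.specialUnitaryGroup (Fin 2) ℂ)),
      ‖v‖ ≤ r * θ → ‖v'‖ ≤ r * θ → PlaqSmall θ U → PlaqSmall θ V → PlaqSmall θ W → PlaqSmall θ Z →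
      (∀ e, e ≠ b → V e = U e) → V b = U b * expPt v → (∀ e, e ≠ b' → W e = U e) → W b' = U b' * expPt v' →
      (∀ e, e ≠ b' → Z e = V e) → Z b' = V b' * expPt v' →
      |R Z - R V - R W + R U| ≤ k b b' * (‖v‖ / θ) * (‖v'‖ / θ)) :
    ∀ (b b' : PBond P j) (v v' : Fin 3 → ℝ) (U V W Z : GaugeField P j (Matrix.specialUnitaryGroup (Fin 2) ℂ)),
      ‖v‖ ≤ r * θ → ‖v'‖ ≤ r * θ → PlaqSmall θ U → PlaqSmall θ V → PlaqSmall θ W → PlaqSmall θ Z →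
      (∀ e, e ≠ b → V e = U e) → V b = U b * expPt v → (∀ e, e ≠ b' → W e = U e) → W b' = U b' * expPt v' →
      (∀ e, e ≠ b' → Z e = V e) → Z b' = V b' * expPt v' →
      |(-R Z) - (-R V) - (-R W) + (-R U)| ≤ k b b' * (‖v‖ / θ) * (‖v'‖ / θ) := by
  intro b b' v v' U V W Z hv hv' hU hV hW hZ e1 e2 e3 e4 e5 e6
  have A := h b b' v v' U V W Z hv hv' hU hV hW hZ e1 e2 e3 e4 e5 e6
  have e : (-R Z) - (-R V) - (-R W) + (-R U) = -(R Z - R V - R W + R U) := by ring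
  rwa [e, abs_neg]

/-- (K2) **SUBTRACTION**: clauses for `R₁` (letters `k₁`) and `R₂` (letters `k₂`) give the clause for `R₁ − R₂` with letters `k₁ + k₂`. [folklore] -/
theorem hClauseSq_sub
    (h₁ : ∀ (b b' : PBond P j) (v v' : Fin 3 → ℝ) (U V W Z : GaugeField P j (Matrix.specialUnitaryGroup (Fin 2) ℂ)),
      ‖v‖ ≤ r * θ → ‖v'‖ ≤ r * θ → PlaqSmall θ U → PlaqSmall θ V → PlaqSmall θ W → PlaqSmall θ Z →
      (∀ e, e ≠ b → V e = U e) → V b = U b * expPt v → (∀ e, e ≠ b' → W e = U e) → W b' = U b' * expPt v' →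
      (∀ e, e ≠ b' → Z e = V e) → Z b' = V b' * expPt v' →
      |R₁ Z - R₁ V - R₁ W + R₁ U| ≤ k₁ b b' * (‖v‖ / θ) * (‖v'‖ / θ))
    (h₂ : ∀ (b b' : PBond P j) (v v' : Fin 3 → ℝ) (U V W Z : GaugeField P j (Matrix.specialUnitaryGroup (Fin 2) ℂ)),
      ‖v‖ ≤ r * θ → ‖v'‖ ≤ r * θ → PlaqSmall θ U → PlaqSmall θ V → PlaqSmall θ W → PlaqSmall θ Z →
      (∀ e, e ≠ b → V e = U e) → V b = U b * expPt v → (∀ e, e ≠ b' → W e = U e) → W b' = U b' * expPt v' →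
      (∀ e, e ≠ b' → Z e = V e) → Z b' = V b' * expPt v' →
      |R₂ Z - R₂ V - R₂ W + R₂ U| ≤ k₂ b b' * (‖v‖ / θ) * (‖v'‖ / θ)) :
    ∀ (b b' : PBond P j) (v v' : Fin 3 → ℝ) (U V W Z : GaugeField P j (Matrix.specialUnitaryGroup (Fin 2) ℂ)),
      ‖v‖ ≤ r * θ → ‖v'‖ ≤ r * θ → PlaqSmall θ U → PlaqSmall θ V → PlaqSmall θ W → PlaqSmall θ Z →
      (∀ e, e ≠ b → V e = U e) → V b = U b * expPt v → (∀ e, e ≠ b' → W e = U e) → W b' = U b' * expPt v' →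
      (∀ e, e ≠ b' → Z e = V e) → Z b' = V b' * expPt v' →
      |(R₁ Z - R₂ Z) - (R₁ V - R₂ V) - (R₁ W - R₂ W) + (R₁ U - R₂ U)| ≤ (k₁ b b' + k₂ b b') * (‖v‖ / θ) * (‖v'‖ / θ) := by
  intro b b' v v' U V W Z hv hv' hU hV hW hZ e1 e2 e3 e4 e5 e6
  have A := h₁ b b' v v' U V W Z hv hv' hU hV hW hZ e1 e2 e3 e4 e5 e6
  have B := h₂ b b' v v' U V W Z hv hv' hU hV hW hZ e1 e2 e3 e4 e5 e6
  have e : (R₁ Z - R₂ Z) - (R₁ V - R₂ V) - (R₁ W - R₂ W) + (R₁ U - R₂ U) =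
      (R₁ Z - R₁ V - R₁ W + R₁ U) - (R₂ Z - R₂ V - R₂ W + R₂ U) := by ring
  rw [e, add_mul, add_mul]
  exact (abs_sub _ _).trans (add_le_add A B)

/-- (K3) **THE CAP IS ANTITONE**: a clause valid for moves of size `≤ r·θ` is valid for moves of size `≤ r'·θ`, `r' ≤ r` (`0 ≤ θ`). [folklore] -/
theorem hClauseSq_cap_mono {r' : ℝ} (hθ : 0 ≤ θ) (hr : r' ≤ r)
    (h : ∀ (b b' : PBond P j) (v v' : Fin 3 → ℝ) (U V W Z : GaugeField P j (Matrix.specialUnitaryGroup (Fin 2) ℂ)),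
      ‖v‖ ≤ r * θ → ‖v'‖ ≤ r * θ → PlaqSmall θ U → PlaqSmall θ V → PlaqSmall θ W → PlaqSmall θ Z →
      (∀ e, e ≠ b → V e = U e) → V b = U b * expPt v → (∀ e, e ≠ b' → W e = U e) → W b' = U b' * expPt v' →
      (∀ e, e ≠ b' → Z e = V e) → Z b' = V b' * expPt v' →
      |R Z - R V - R W + R U| ≤ k b b' * (‖v‖ / θ) * (‖v'‖ / θ)) :
    ∀ (b b' : PBond P j) (v v' : Fin 3 → ℝ) (U V W Z : GaugeField P j (Matrix.specialUnitaryGroup (Fin 2) ℂ)),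
      ‖v‖ ≤ r' * θ → ‖v'‖ ≤ r' * θ → PlaqSmall θ U → PlaqSmall θ V → PlaqSmall θ W → PlaqSmall θ Z →
      (∀ e, e ≠ b → V e = U e) → V b = U b * expPt v → (∀ e, e ≠ b' → W e = U e) → W b' = U b' * expPt v' →
      (∀ e, e ≠ b' → Z e = V e) → Z b' = V b' * expPt v' →
      |R Z - R V - R W + R U| ≤ k b b' * (‖v‖ / θ) * (‖v'‖ / θ) := by
  intro b b' v v' U V W Z hv hv' hU hV hW hZ e1 e2 e3 e4 e5 e6
  have hrr : r' * θ ≤ r * θ := mul_le_mul_of_nonneg_right hr hθ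
  exact h b b' v v' U V W Z (hv.trans hrr) (hv'.trans hrr) hU hV hW hZ e1 e2 e3 e4 e5 e6

/-- (K3) **LETTER MONOTONICITY**: larger letters `k ≤ k'` keep the clause. [folklore] -/
theorem hClauseSq_letter_mono (hk : ∀ b b', k b b' ≤ k' b b')
    (h : ∀ (b b' : PBond P j) (v v' : Fin 3 → ℝ) (U V W Z : GaugeField P j (Matrix.specialUnitaryGroup (Fin 2) ℂ)),
      ‖v‖ ≤ r * θ → ‖v'‖ ≤ r * θ → PlaqSmall θ U → PlaqSmall θ V → PlaqSmall θ W → PlaqSmall θ Z →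
      (∀ e, e ≠ b → V e = U e) → V b = U b * expPt v → (∀ e, e ≠ b' → W e = U e) → W b' = U b' * expPt v' →
      (∀ e, e ≠ b' → Z e = V e) → Z b' = V b' * expPt v' →
      |R Z - R V - R W + R U| ≤ k b b' * (‖v‖ / θ) * (‖v'‖ / θ)) :
    ∀ (b b' : PBond P j) (v v' : Fin 3 → ℝ) (U V W Z : GaugeField P j (Matrix.specialUnitaryGroup (Fin 2) ℂ)),
      ‖v‖ ≤ r * θ → ‖v'‖ ≤ r * θ → PlaqSmall θ U → PlaqSmall θ V → PlaqSmall θ W → PlaqSmall θ Z →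
      (∀ e, e ≠ b → V e = U e) → V b = U b * expPt v → (∀ e, e ≠ b' → W e = U e) → W b' = U b' * expPt v' →
      (∀ e, e ≠ b' → Z e = V e) → Z b' = V b' * expPt v' →
      |R Z - R V - R W + R U| ≤ k' b b' * (‖v‖ / θ) * (‖v'‖ / θ) :=
  hClauseSq_congr h (fun _ _ => rfl) hk

/-- (K4) **WINDOW ∕ SCALE CHANGE**: a clause at window `θ` and cap `r` restricts to any smaller window `0 < θ' ≤ θ` with any cap `r'` such that
`r'·θ' ≤ r·θ`, the letters becoming `(θ'∕θ)²·k` (the size normalisation `‖v‖∕θ` is re-expressed in units of `θ'`; `PlaqSmall` is monotone,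
lit ✓`plaqSmall_of_le`). [folklore] -/
theorem hClauseSq_window {θ' r' : ℝ} (hθ' : 0 < θ') (hθθ : θ' ≤ θ) (hrr : r' * θ' ≤ r * θ)
    (h : ∀ (b b' : PBond P j) (v v' : Fin 3 → ℝ) (U V W Z : GaugeField P j (Matrix.specialUnitaryGroup (Fin 2) ℂ)),
      ‖v‖ ≤ r * θ → ‖v'‖ ≤ r * θ → PlaqSmall θ U → PlaqSmall θ V → PlaqSmall θ W → PlaqSmall θ Z →
      (∀ e, e ≠ b → V e = U e) → V b = U b * expPt v → (∀ e, e ≠ b' → W e = U e) → W b' = U b' * expPt v' →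
      (∀ e, e ≠ b' → Z e = V e) → Z b' = V b' * expPt v' →
      |R Z - R V - R W + R U| ≤ k b b' * (‖v‖ / θ) * (‖v'‖ / θ)) :
    ∀ (b b' : PBond P j) (v v' : Fin 3 → ℝ) (U V W Z : GaugeField P j (Matrix.specialUnitaryGroup (Fin 2) ℂ)),
      ‖v‖ ≤ r' * θ' → ‖v'‖ ≤ r' * θ' → PlaqSmall θ' U → PlaqSmall θ' V → PlaqSmall θ' W → PlaqSmall θ' Z →
      (∀ e, e ≠ b → V e = U e) → V b = U b * expPt v → (∀ e, e ≠ b' → W e = U e) → W b' = U b' * expPt v' →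
      (∀ e, e ≠ b' → Z e = V e) → Z b' = V b' * expPt v' →
      |R Z - R V - R W + R U| ≤ ((θ' / θ) ^ 2 * k b b') * (‖v‖ / θ') * (‖v'‖ / θ') := by
  intro b b' v v' U V W Z hv hv' hU hV hW hZ e1 e2 e3 e4 e5 e6
  have hθ : 0 < θ := lt_of_lt_of_le hθ' hθθ
  have A := h b b' v v' U V W Z (hv.trans hrr) (hv'.trans hrr) (plaqSmall_of_le hθθ hU) (plaqSmall_of_le hθθ hV)
    (plaqSmall_of_le hθθ hW) (plaqSmall_of_le hθθ hZ) e1 e2 e3 e4 e5 e6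
  have e : ((θ' / θ) ^ 2 * k b b') * (‖v‖ / θ') * (‖v'‖ / θ') = k b b' * (‖v‖ / θ) * (‖v'‖ / θ) := by
    field_simp
  rw [e]
  exact A

/-- (K5) **CONSTANTS**: a configuration-independent function satisfies the clause with ZERO letters (any window, any cap). [folklore] -/
theorem hClauseSq_const (θ r c : ℝ) :
    ∀ (b b' : PBond P j) (v v' : Fin 3 → ℝ) (U V W Z : GaugeField P j (Matrix.specialUnitaryGroup (Fin 2) ℂ)),
      ‖v‖ ≤ r * θ → ‖v'‖ ≤ r * θ → PlaqSmall θ U → PlaqSmall θ V → PlaqSmall θ W → PlaqSmall θ Z →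
      (∀ e, e ≠ b → V e = U e) → V b = U b * expPt v → (∀ e, e ≠ b' → W e = U e) → W b' = U b' * expPt v' →
      (∀ e, e ≠ b' → Z e = V e) → Z b' = V b' * expPt v' →
      |(fun _ => c) Z - (fun _ => c) V - (fun _ => c) W + (fun _ => c) U| ≤
        (fun (_ _ : PBond P j) => (0 : ℝ)) b b' * (‖v‖ / θ) * (‖v'‖ / θ) := by
  intro b b' v v' U V W Z _ _ _ _ _ _ _ _ _ _ _ _
  simp

/-- (K5) **BOND-INDEPENDENT ADDENDS**: adding a constant to `R` keeps the clause and its letters. [folklore] -/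
theorem hClauseSq_add_const (c : ℝ)
    (h : ∀ (b b' : PBond P j) (v v' : Fin 3 → ℝ) (U V W Z : GaugeField P j (Matrix.specialUnitaryGroup (Fin 2) ℂ)),
      ‖v‖ ≤ r * θ → ‖v'‖ ≤ r * θ → PlaqSmall θ U → PlaqSmall θ V → PlaqSmall θ W → PlaqSmall θ Z →
      (∀ e, e ≠ b → V e = U e) → V b = U b * expPt v → (∀ e, e ≠ b' → W e = U e) → W b' = U b' * expPt v' →
      (∀ e, e ≠ b' → Z e = V e) → Z b' = V b' * expPt v' →
      |R Z - R V - R W + R U| ≤ k b b' * (‖v‖ / θ) * (‖v'‖ / θ)) :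
    ∀ (b b' : PBond P j) (v v' : Fin 3 → ℝ) (U V W Z : GaugeField P j (Matrix.specialUnitaryGroup (Fin 2) ℂ)),
      ‖v‖ ≤ r * θ → ‖v'‖ ≤ r * θ → PlaqSmall θ U → PlaqSmall θ V → PlaqSmall θ W → PlaqSmall θ Z →
      (∀ e, e ≠ b → V e = U e) → V b = U b * expPt v → (∀ e, e ≠ b' → W e = U e) → W b' = U b' * expPt v' →
      (∀ e, e ≠ b' → Z e = V e) → Z b' = V b' * expPt v' →
      |(R Z + c) - (R V + c) - (R W + c) + (R U + c)| ≤ k b b' * (‖v‖ / θ) * (‖v'‖ / θ) := by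
  intro b b' v v' U V W Z hv hv' hU hV hW hZ e1 e2 e3 e4 e5 e6
  have e : (R Z + c) - (R V + c) - (R W + c) + (R U + c) = R Z - R V - R W + R U := by ring
  rw [e]
  exact h b b' v v' U V W Z hv hv' hU hV hW hZ e1 e2 e3 e4 e5 e6

/-- (K7) **CLOSURE UNDER AVERAGES**: if `R U = ∫ w t · S t U dμ(t)` on the `θ`-window for a finite measure `μ`, a weight `|w| ≤ B` and a family
`S t` each satisfying the clause with the SAME letters `k` (integrands integrable on the window), then `R` satisfies the clause with letters
`B·μ(T)·k` — the shape of every Jensen ∕ cumulant ∕ interpolation representation of the lane. [folklore] -/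
theorem hClauseSq_integral {T : Type*} [MeasurableSpace T] (μ : Measure T) [IsFiniteMeasure μ]
    {S : T → GaugeField P j (Matrix.specialUnitaryGroup (Fin 2) ℂ) → ℝ} {w : T → ℝ} {B : ℝ} (hw : ∀ t, |w t| ≤ B)
    (hS : ∀ t, ∀ (b b' : PBond P j) (v v' : Fin 3 → ℝ) (U V W Z : GaugeField P j (Matrix.specialUnitaryGroup (Fin 2) ℂ)),
      ‖v‖ ≤ r * θ → ‖v'‖ ≤ r * θ → PlaqSmall θ U → PlaqSmall θ V → PlaqSmall θ W → PlaqSmall θ Z →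
      (∀ e, e ≠ b → V e = U e) → V b = U b * expPt v → (∀ e, e ≠ b' → W e = U e) → W b' = U b' * expPt v' →
      (∀ e, e ≠ b' → Z e = V e) → Z b' = V b' * expPt v' →
      |S t Z - S t V - S t W + S t U| ≤ k b b' * (‖v‖ / θ) * (‖v'‖ / θ))
    (hint : ∀ U, PlaqSmall θ U → Integrable (fun t => w t * S t U) μ)
    (hR : ∀ U, PlaqSmall θ U → R U = ∫ t, w t * S t U ∂μ) :
    ∀ (b b' : PBond P j) (v v' : Fin 3 → ℝ) (U V W Z : GaugeField P j (Matrix.specialUnitaryGroup (Fin 2) ℂ)),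
      ‖v‖ ≤ r * θ → ‖v'‖ ≤ r * θ → PlaqSmall θ U → PlaqSmall θ V → PlaqSmall θ W → PlaqSmall θ Z →
      (∀ e, e ≠ b → V e = U e) → V b = U b * expPt v → (∀ e, e ≠ b' → W e = U e) → W b' = U b' * expPt v' →
      (∀ e, e ≠ b' → Z e = V e) → Z b' = V b' * expPt v' →
      |R Z - R V - R W + R U| ≤ (B * (μ Set.univ).toReal * k b b') * (‖v‖ / θ) * (‖v'‖ / θ) := by
  intro b b' v v' U V W Z hv hv' hU hV hW hZ e1 e2 e3 e4 e5 e6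
  have I1 := hint Z hZ
  have I2 := hint V hV
  have I3 := hint W hW
  have I4 := hint U hU
  have I12 : Integrable (fun t => w t * S t Z - w t * S t V) μ := I1.sub I2
  have I123 : Integrable (fun t => w t * S t Z - w t * S t V - w t * S t W) μ := I12.sub I3
  have q1 : ∫ t, (w t * S t Z - w t * S t V) ∂μ = (∫ t, w t * S t Z ∂μ) - ∫ t, w t * S t V ∂μ := integral_sub I1 I2
  have q2 : ∫ t, (w t * S t Z - w t * S t V - w t * S t W) ∂μ = (∫ t, (w t * S t Z - w t * S t V) ∂μ) - ∫ t, w t * S t W ∂μ :=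
    integral_sub I12 I3
  have q3 : ∫ t, (w t * S t Z - w t * S t V - w t * S t W + w t * S t U) ∂μ =
      (∫ t, (w t * S t Z - w t * S t V - w t * S t W) ∂μ) + ∫ t, w t * S t U ∂μ := integral_add I123 I4
  rw [hR U hU, hR V hV, hR W hW, hR Z hZ, ← q1, ← q2, ← q3]
  have hpt : ∀ᵐ t ∂μ, ‖w t * S t Z - w t * S t V - w t * S t W + w t * S t U‖ ≤ B * (k b b' * (‖v‖ / θ) * (‖v'‖ / θ)) := by
    refine Filter.Eventually.of_forall fun t => ?_
    have A := hS t b b' v v' U V W Z hv hv' hU hV hW hZ e1 e2 e3 e4 e5 e6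
    have hB : 0 ≤ B := (abs_nonneg _).trans (hw t)
    have e : w t * S t Z - w t * S t V - w t * S t W + w t * S t U = w t * (S t Z - S t V - S t W + S t U) := by ring
    rw [Real.norm_eq_abs, e, abs_mul]
    exact mul_le_mul (hw t) A (abs_nonneg _) hB
  have I := norm_integral_le_of_norm_le_const hpt
  rw [Real.norm_eq_abs, measureReal_def] at I
  refine I.trans (le_of_eq ?_)
  ring

end Clause

/-! ## §2 The row-mass algebra (`∀ b, Σ_{b'} k b b'·e^{κ·tdist} ≤ w`) -/

section RowMass

variable {κ w w₁ w₂ : ℝ} {k k₁ k₂ k' : PBond P j → PBond P j → ℝ}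

/-- (K6) **ROW MASSES ADD**. [folklore] -/
theorem rowMass_add_le (h₁ : ∀ b, ∑ b', k₁ b b' * Real.exp (κ * (b.src.tdist b'.src : ℝ)) ≤ w₁)
    (h₂ : ∀ b, ∑ b', k₂ b b' * Real.exp (κ * (b.src.tdist b'.src : ℝ)) ≤ w₂) (b : PBond P j) :
    ∑ b', (k₁ b b' + k₂ b b') * Real.exp (κ * (b.src.tdist b'.src : ℝ)) ≤ w₁ + w₂ := by
  have e : (∑ b', (k₁ b b' + k₂ b b') * Real.exp (κ * (b.src.tdist b'.src : ℝ))) =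
      (∑ b', k₁ b b' * Real.exp (κ * (b.src.tdist b'.src : ℝ))) + ∑ b', k₂ b b' * Real.exp (κ * (b.src.tdist b'.src : ℝ)) := by
    rw [← Finset.sum_add_distrib]
    exact Finset.sum_congr rfl (fun b' _ => add_mul _ _ _)
  rw [e]
  exact add_le_add (h₁ b) (h₂ b)

/-- (K6) **ROW MASSES OF FINITE SUMS**. [folklore] -/
theorem rowMass_sum_le {ι : Type*} (s : Finset ι) {kf : ι → PBond P j → PBond P j → ℝ} {wf : ι → ℝ}
    (h : ∀ i ∈ s, ∀ b, ∑ b', kf i b b' * Real.exp (κ * (b.src.tdist b'.src : ℝ)) ≤ wf i) (b : PBond P j) :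
    ∑ b', (∑ i ∈ s, kf i b b') * Real.exp (κ * (b.src.tdist b'.src : ℝ)) ≤ ∑ i ∈ s, wf i := by
  have e : (∑ b', (∑ i ∈ s, kf i b b') * Real.exp (κ * (b.src.tdist b'.src : ℝ))) =
      ∑ i ∈ s, ∑ b', kf i b b' * Real.exp (κ * (b.src.tdist b'.src : ℝ)) := by
    rw [Finset.sum_comm]
    exact Finset.sum_congr rfl (fun b' _ => Finset.sum_mul _ _ _)
  rw [e]
  exact Finset.sum_le_sum fun i hi => h i hi b

/-- (K6) **NON-NEGATIVE SCALARS**: `rowMass (c·k) ≤ c·w` for `0 ≤ c`. [folklore] -/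
theorem rowMass_smul_le {c : ℝ} (hc : 0 ≤ c) (h : ∀ b, ∑ b', k b b' * Real.exp (κ * (b.src.tdist b'.src : ℝ)) ≤ w) (b : PBond P j) :
    ∑ b', (c * k b b') * Real.exp (κ * (b.src.tdist b'.src : ℝ)) ≤ c * w := by
  have e : (∑ b', (c * k b b') * Real.exp (κ * (b.src.tdist b'.src : ℝ))) = c * ∑ b', k b b' * Real.exp (κ * (b.src.tdist b'.src : ℝ)) := by
    rw [Finset.mul_sum]
    exact Finset.sum_congr rfl (fun b' _ => mul_assoc _ _ _)
  rw [e]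
  exact mul_le_mul_of_nonneg_left (h b) hc

/-- (K6) **SCALARS**: `rowMass (|c|·k) ≤ |c|·w`. [folklore] -/
theorem rowMass_abs_smul_le (c : ℝ) (h : ∀ b, ∑ b', k b b' * Real.exp (κ * (b.src.tdist b'.src : ℝ)) ≤ w) (b : PBond P j) :
    ∑ b', (|c| * k b b') * Real.exp (κ * (b.src.tdist b'.src : ℝ)) ≤ |c| * w :=
  rowMass_smul_le (abs_nonneg c) h b

/-- (K6) **ZERO LETTERS** have row mass `0 ≤ w` for any `0 ≤ w`. [folklore] -/
theorem rowMass_zero_le (hw : 0 ≤ w) (b : PBond P j) :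
    ∑ b', (fun (_ _ : PBond P j) => (0 : ℝ)) b b' * Real.exp (κ * (b.src.tdist b'.src : ℝ)) ≤ w := by
  simpa using hw

/-- (K6) **SMALLER LETTERS, SMALLER ROW MASS**: `k ≤ k'` pointwise and `rowMass k' ≤ w` give `rowMass k ≤ w`. [folklore] -/
theorem rowMass_le_of_letter_le (hk : ∀ b b', k b b' ≤ k' b b') (h : ∀ b, ∑ b', k' b b' * Real.exp (κ * (b.src.tdist b'.src : ℝ)) ≤ w)
    (b : PBond P j) : ∑ b', k b b' * Real.exp (κ * (b.src.tdist b'.src : ℝ)) ≤ w :=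
  (Finset.sum_le_sum fun b' _ => mul_le_mul_of_nonneg_right (hk b b') (Real.exp_nonneg _)).trans (h b)

/-- (K6) **WINDOW CHANGE ON THE ROW MASS**: the letters `(θ'∕θ)²·k` of (K4) have row mass `≤ (θ'∕θ)²·w`. [folklore] -/
theorem rowMass_window_le (θ θ' : ℝ) (h : ∀ b, ∑ b', k b b' * Real.exp (κ * (b.src.tdist b'.src : ℝ)) ≤ w) (b : PBond P j) :
    ∑ b', ((θ' / θ) ^ 2 * k b b') * Real.exp (κ * (b.src.tdist b'.src : ℝ)) ≤ (θ' / θ) ^ 2 * w :=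
  rowMass_smul_le (sq_nonneg _) h b

end RowMass

end Summit.QuantumFields.YangMills.Theorems.OrganTangentHClauseAlgebra

end
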